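import Mathlib
import HarnessLib

/-!
# Witness bounds for the smallest singular value: a certified floor is at most any Rayleigh-type quotient

Throughout the cell's certified sparse solvers (`cap.ila.gen`, kinds `sparse-aug-inertia/1`, `sparse-lu-split/1`, …) the
statement «`s` is a lower bound of `σ_min(A)`» is the predicate `∀ v, s‖v‖₂ ≤ ‖Av‖₂` (see
`Literature.Analysis.Matrix.SingularValueVerification.isUnit_det_of_sigma_lower`,
`Literature.Analysis.Matrix.InertiaSigmaMin.sigma_lower_of_augmented_inertia`,
`Literature.Analysis.Matrix.AugmentedInertia.sigma_lower_of_augmented_certificate`).  Such a floor is CERTIFIED but its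
TIGHTNESS is not: the certificate says nothing about how far `s` is below `σ_min(A)`.

This file records the elementary complement used to turn a floor into a two-sided ENCLOSURE: for ANY nonzero witness
vector `v₀` (in practice the inverse-iteration vector the producer already holds), every such `s` satisfies
`s ≤ ‖Av₀‖₂ / ‖v₀‖₂`; with machine-checkable outward bounds `‖Av₀‖₂ ≤ U` and `0 < L ≤ ‖v₀‖₂` this reads `s ≤ U / L`, so a
producer may print `σ_min ∈ [σ_lo, σ_hi]` with `σ_hi := U / L` and a reader knows `σ_lo ≤ σ_hi` is forced.  Dually, a
certified operator-norm ceiling `M` (`∀ v, ‖Av‖₂ ≤ M‖v‖₂`, e.g. the Collatz/Schur bound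
`SparseLUSplit.norm_toLp_mulVec_le_sqrt_of_abs_le_collatz`) is at least any witnessed quotient, and for an invertible `A` the
witness also bounds the inverse from BELOW: `‖A⁻¹(Av₀)‖₂ = ‖v₀‖₂`, i.e. `‖A⁻¹‖₂ ≥ ‖v₀‖₂/‖Av₀‖₂ = 1/σ_hi`, complementing the
certified `‖A⁻¹b‖₂ ≤ ‖b‖₂/s` of `SingularValueVerification.norm_toLp_inv_mulVec_sub_le`.

These are folklore consequences of the definitions (Courant–Fischer needs no mention); the verified-numerics context —
two-sided verified bounds for singular values and for the spectral norm of a matrix and its inverse — is Rump's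
[cite: Rump2011SingularValues, §1]; the variational characterisations being specialised are [cite: Bernstein2009, Fact 9.13.1] (σ_max as a max, σ_min as a min of ‖Ax‖₂/‖x‖₂ over x ≠ 0) and the inverse relation [cite: Bernstein2009, Fact 6.3.28].  Everything here is PROVED; no named fact; real matrices and the Euclidean norm via
`WithLp.toLp 2` as in the sibling files.  Deliberately NOT here: any statement about Mathlib's singular values as such (the
cell's certificates speak the `∀ v` predicate), floating-point error analysis of `U`, `L` (the producer's job under H-IEEE).
-/

open scoped Matrix

namespace Literature.Analysis.Matrix.SigmaMinWitness

open _root_.Matrix WithLp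

variable {n : Type*} [Fintype n]

/-- `toLp 2 v` has positive norm iff `v ≠ 0` (plumbing for the quotients below). [folklore] -/
private theorem norm_toLp_pos_iff (v : n → ℝ) : 0 < ‖toLp 2 v‖ ↔ v ≠ 0 := by
  rw [norm_pos_iff, ne_eq, ne_eq, toLp_eq_zero]

/-- **A certified σ-floor lies below every witnessed quotient.** If `s‖v‖₂ ≤ ‖Av‖₂` for all `v` (the cell's
«`s ≤ σ_min(A)`» predicate) and `v₀ ≠ 0`, then `s ≤ ‖Av₀‖₂ / ‖v₀‖₂` — the «≤ every quotient» half of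
`σ_min(A) = min_{x ≠ 0} ‖Ax‖₂/‖x‖₂`. [cite: Bernstein2009, Fact 9.13.1 (σ_min as the minimum of the quotient, n = m)] -/
theorem sigma_lower_le_div_of_witness {A : Matrix n n ℝ} {s : ℝ}
    (hA : ∀ v : n → ℝ, s * ‖toLp 2 v‖ ≤ ‖toLp 2 (A *ᵥ v)‖) {v₀ : n → ℝ} (hv : v₀ ≠ 0) :
    s ≤ ‖toLp 2 (A *ᵥ v₀)‖ / ‖toLp 2 v₀‖ := by
  rw [le_div_iff₀ ((norm_toLp_pos_iff v₀).2 hv)]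
  exact hA v₀

/-- **Float-side shape of the upper witness.** With an outward upper bound `U ≥ ‖Av₀‖₂` and an outward lower bound
`0 < L ≤ ‖v₀‖₂` (directed rounding on the producer's side), every certified floor satisfies `s ≤ U / L` — the
certificate's `σ_hi` (the same Fact with outward-rounded numerator and denominator). [cite: Bernstein2009, Fact 9.13.1 (σ_min as the minimum of the quotient), outward form] -/
theorem sigma_lower_le_div_of_bounds {A : Matrix n n ℝ} {s U L : ℝ}
    (hA : ∀ v : n → ℝ, s * ‖toLp 2 v‖ ≤ ‖toLp 2 (A *ᵥ v)‖) {v₀ : n → ℝ}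
    (hU : ‖toLp 2 (A *ᵥ v₀)‖ ≤ U) (hL : L ≤ ‖toLp 2 v₀‖) (hLpos : 0 < L) :
    s ≤ U / L := by
  have hvpos : 0 < ‖toLp 2 v₀‖ := lt_of_lt_of_le hLpos hL
  have hv : v₀ ≠ 0 := (norm_toLp_pos_iff v₀).1 hvpos
  have hU0 : 0 ≤ U := le_trans (norm_nonneg _) hU
  calc s ≤ ‖toLp 2 (A *ᵥ v₀)‖ / ‖toLp 2 v₀‖ := sigma_lower_le_div_of_witness hA hv
    _ ≤ U / ‖toLp 2 v₀‖ := by gcongr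
    _ ≤ U / L := by gcongr

/-- **A certified operator-norm ceiling lies above every witnessed quotient.** If `‖Av‖₂ ≤ M‖v‖₂` for all `v` and
`v₀ ≠ 0`, then `‖Av₀‖₂ / ‖v₀‖₂ ≤ M` (so a printed `‖A‖₂ ∈ [‖Av₀‖₂/‖v₀‖₂, M]` is consistent) — the «≥ every quotient» half
of `σ_max(A) = max_{x ≠ 0} ‖Ax‖₂/‖x‖₂`. [cite: Bernstein2009, Fact 9.13.1 (σ_max as the maximum of the quotient)] -/
theorem div_le_of_opNorm_bound {A : Matrix n n ℝ} {M : ℝ}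
    (hM : ∀ v : n → ℝ, ‖toLp 2 (A *ᵥ v)‖ ≤ M * ‖toLp 2 v‖) {v₀ : n → ℝ} (hv : v₀ ≠ 0) :
    ‖toLp 2 (A *ᵥ v₀)‖ / ‖toLp 2 v₀‖ ≤ M := by
  rw [div_le_iff₀ ((norm_toLp_pos_iff v₀).2 hv)]
  exact hM v₀

/-- **Floor below ceiling.** A certified σ-floor `s` and a certified operator-norm ceiling `M` of the same matrix on a
nonempty index type satisfy `s ≤ M` (take any nonzero witness): `σ_min ≤ σ_max` in the cell's predicate language.
[cite: Bernstein2009, Fact 9.13.1 (both characterisations at one witness)] -/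
theorem sigma_lower_le_opNorm_bound [Nonempty n] {A : Matrix n n ℝ} {s M : ℝ}
    (hA : ∀ v : n → ℝ, s * ‖toLp 2 v‖ ≤ ‖toLp 2 (A *ᵥ v)‖)
    (hM : ∀ v : n → ℝ, ‖toLp 2 (A *ᵥ v)‖ ≤ M * ‖toLp 2 v‖) : s ≤ M := by
  obtain ⟨i⟩ := ‹Nonempty n›
  have hv : (fun _ : n => (1 : ℝ)) ≠ 0 := by
    intro h; have := congr_fun h i; simp at this
  exact le_trans (sigma_lower_le_div_of_witness hA hv) (div_le_of_opNorm_bound hM hv)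

variable [DecidableEq n]

/-- **The witness bounds the inverse from below.** For `A` with `det A` a unit, `‖A⁻¹(Av₀)‖₂ = ‖v₀‖₂`; hence the right-hand
side `b := Av₀` realises `‖A⁻¹b‖₂/‖b‖₂ = ‖v₀‖₂/‖Av₀‖₂`, i.e. `‖A⁻¹‖₂ ≥ 1/σ_hi` — the companion of the certified
`‖A⁻¹b‖₂ ≤ ‖b‖₂/σ_lo`; the witness form of `σ_min(A) = 1/σ_max(A⁻¹)`. [cite: Bernstein2009, Fact 6.3.28 (σ_min(A) = 1/σ_max(A⁻¹), witness form)] -/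
theorem norm_inv_mulVec_mulVec_eq {A : Matrix n n ℝ} (hA : IsUnit A.det) (v₀ : n → ℝ) :
    ‖toLp 2 (A⁻¹ *ᵥ (A *ᵥ v₀))‖ = ‖toLp 2 v₀‖ := by
  rw [mulVec_mulVec, nonsing_inv_mul A hA, one_mulVec]

/-- Two-sided reading for the inverse: under a certified floor `0 < s` (so `A` is invertible by
`SingularValueVerification.isUnit_det_of_sigma_lower`) and a witness `v₀` with `Av₀ ≠ 0`, the particular right-hand side
`b = Av₀` has `‖A⁻¹b‖₂ = ‖v₀‖₂ ≥ ‖b‖₂ / (‖Av₀‖₂/‖v₀‖₂)`… stated without division: `‖b‖₂ · ‖v₀‖₂ = ‖A⁻¹ b‖₂ · ‖A v₀‖₂`.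
[cite: Bernstein2009, Fact 6.3.28 (σ_min(A) = 1/σ_max(A⁻¹), witness form without division)] -/
theorem norm_mul_norm_eq_norm_inv_mulVec_mul {A : Matrix n n ℝ} (hA : IsUnit A.det) (v₀ : n → ℝ) :
    ‖toLp 2 (A *ᵥ v₀)‖ * ‖toLp 2 v₀‖ = ‖toLp 2 (A⁻¹ *ᵥ (A *ᵥ v₀))‖ * ‖toLp 2 (A *ᵥ v₀)‖ := by
  rw [norm_inv_mulVec_mulVec_eq hA, mul_comm]

end Literature.Analysis.Matrix.SigmaMinWitness
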